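import Literature.MathematicalPhysics.QuantumFieldTheory.Balaban1983to89.T4AdInvariant

/-!
# T⁴ programme, spine estimate NE1′ (node O3b/H2) — SYMMETRY CENTRES THE NONLINEAR DISPLACEMENT AT A FLAT EXTERIOR: the first-order
# channel of the swap, for ONE fibre at the measure level, vanishes by `T4AdInvariant` — kernel modulo the tree's hypothesis shape (α)

Cell `pub-balaban-gaps` (YM blitz Y1, track G2), seat `ne1` gen 7 (prover-pub-balaban-gaps-ne1-g7-0), record `HOME/ne/NE1.md` §4 row
R46 (c) (gen 7).  ADDITIVE — imports the b2b cell's `Literature/…/T4AdInvariant` (row T4-O3.E-i′.K: `FlatExteriorConjInvariant`,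
`ConjEquivariant`, `integral_eq_zero_of_conjEquivariant` — consumed BY NAME, nothing edited) ONLY; Mathlib otherwise.  Siblings (same
generation): `TiltedMeanSmoothDualCritical` (the fibred swap under a general transfer over FINITE fibres; criticality × flatness),
`TiltedMeanSmoothDualCriticalTilt` (the tilt family; the ledger letter `θ₁φΛ`).

WHY.  The sibling `TiltedMeanSmoothDualCritical` locates the input that gen 6's linearised model hid: under a NONLINEAR transfer a
fibre law centred in the slot variable does not centre the DISPLACEMENT of the unit field, and the first-order channel of the swap
survives (attained) unless the displacement itself is centred or the test function is critical.  The record's READING (NE1.md R28 (2),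
R46 (c)) is that conjugation symmetry centres the displacement at a flat exterior TO ALL ORDERS in the nonlinearity: the unit-lattice
displacement is conjugation-EQUIVARIANT in the slot variable (gauge covariance of the averaging), so its 𝔤-valued logarithm has an
Ad-invariant mean under a conjugation-invariant fibre law, and an Ad-invariant element of 𝔰𝔲(2) is `0`.  This file makes that reading
a KERNEL JOIN with the tree's symmetry module, for ONE fibre at the measure level (no finiteness of the fibre):
* §1 `abs_integral_swap_le_pointwise` — the one-fibre swap for finite measures `κA` (off), `κB` (on) on any measurable space with equal
  mass, unit-field coordinate `φ : X → ℝ` ARBITRARY (measurable, `φ − m ∈ L¹ ∩ L²` under both laws), test function with Taylor majorant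
  `G₂`: `|∫ g∘φ dκB − ∫ g∘φ dκA| ≤ |g'(m)|·|∫ (φ − m) dκB − ∫ (φ − m) dκA| + G₂·(∫ (φ − m)² dκA + ∫ (φ − m)² dκB)` — the measure-level form
  of the sibling's `abs_fibred_swap_le_pointwise` (one exterior).
* §2 THE JOIN: slot configuration space `X` with an SU(2)-action `T`, 𝔤-valued displacement `D : X → (Fin 2 → Fin 2 → ℂ)` pointwise
  traceless and `ConjEquivariant T D` (all orders of the nonlinearity live inside `D`), a real-linear READOUT `e` (one unit-field
  coordinate), `φ x = m + e (D x)`.  Under `FlatExteriorConjInvariant κ T` (the tree's HYPOTHESIS SHAPE (α): the fibre law at a flat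
  exterior is conjugation invariant — NOT settled here or anywhere in the tree) and `Integrable D κ`: `∫ e∘D dκ = 0`
  (`integral_readout_eq_zero`, by `T4AdInvariant.integral_eq_zero_of_conjEquivariant`); hence for two such laws the fibrewise
  mean-displacement discrepancy VANISHES (`flat_discrepancy_eq_zero`).
* §3 `abs_integral_swap_le_of_flatExterior` — at a flat exterior the swap is PURE SECOND ORDER, `≤ G₂·(∫ (e∘D)² dκA + ∫ (e∘D)² dκB)`,
  whatever the nonlinearity inside `D` and with NO centring hypothesis on the slot variable: symmetry does the centring.  Off the flat
  orbit §1's discrepancy term is the flatness channel of the siblings (criticality supplies the second factor there).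
CONSEQUENCE FOR THE ROW (NE1.md v7 R46 (c)).  «Displacement-centring at flat exteriors, all orders» is no longer this seat's reading of
where a lemma applies but a kernel implication from the tree's named shapes `FlatExteriorConjInvariant` (×2: off-law and on-law) and
`ConjEquivariant` (the displacement) — i.e. it sits exactly where the b2b cell put the symmetry half of the first-order suppression
(row T4-O3.E-i′ (α): whether Bałaban's (1.100) quotient laws ARE conjugation invariant at a flat exterior is a READING of [B15]
(1.100)–(1.101) p. 201, obligation (α), open).  Classification of NE1′ UNCHANGED: WORK-bound ∕ OBJECT-bound ∕ NOT idea-bound.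

HONEST FRAMING.  [folklore] measure theory (Bochner integral, linearity, `integral_mono`) over ABSTRACT data plus the tree's SU(2)
Schur-lemma module by name; the hypothesis shapes are NOT instantiated on any law of Bałaban's (no fibre law, action or displacement of
his run is constructed; in the gauge setting a conjugation-invariant law supported on finitely many points is supported on fixed points
— conjugation orbits of non-central elements are spheres —, which is why this file works at the measure level); NE1′ NOT proved; spine 0∕9; (B) 0∕13; one fixed finite T⁴ — NOT ℝ⁴, NOT infinite volume, NOT a mass gap,
NOT Clay.  0 sorry.
-/

noncomputable section

open MeasureTheory
open scoped BigOperators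

namespace Summit.QuantumFields.BalabanUV.T4Continuum.NE1p.TiltedMeanSmoothDualSymmetry

open Literature.MathematicalPhysics.QuantumFieldTheory.Balaban1983to89
open Literature.MathematicalPhysics.QuantumFieldTheory.Balaban1983to89.T4AdInvariant
  (FlatExteriorConjInvariant ConjEquivariant integral_eq_zero_of_conjEquivariant)

/-! ## §1 The one-fibre swap at the measure level, first-order weight pointwise -/

section Swap

variable {X : Type*} [MeasurableSpace X] {κA κB : Measure X} [IsFiniteMeasure κA] [IsFiniteMeasure κB]
  {φ : X → ℝ} {m : ℝ} {g g' : ℝ → ℝ} {G₂ : ℝ}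

/-- Integrability of `g∘φ` from the Taylor decomposition: `g(φ x) = g(m) + (φ x − m)·g'(m) + R x`, `|R x| ≤ G₂(φ x − m)²`. [folklore] -/
theorem integrable_comp_of_taylor {κ : Measure X} [IsFiniteMeasure κ] (hg : ∀ x h : ℝ, |g (x + h) - g x - h * g' x| ≤ G₂ * h ^ 2)
    (hgm : Measurable g) (hφm : Measurable φ) (h1 : Integrable (fun x => φ x - m) κ)
    (h2 : Integrable (fun x => (φ x - m) ^ 2) κ) : Integrable (fun x => g (φ x)) κ := by
  have hR : Integrable (fun x => g (φ x) - g m - (φ x - m) * g' m) κ := by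
    refine Integrable.mono' (h2.const_mul G₂) ((hgm.comp hφm).sub measurable_const |>.sub
      ((hφm.sub measurable_const).mul measurable_const)).aestronglyMeasurable (ae_of_all _ fun x => ?_)
    have h := hg m (φ x - m)
    rw [add_sub_cancel] at h
    simpa only [Real.norm_eq_abs] using h
  have : (fun x => g (φ x)) = fun x => (g (φ x) - g m - (φ x - m) * g' m) + (g m + (φ x - m) * g' m) := by
    funext x; ring
  rw [this]
  exact hR.add ((integrable_const _).add (h1.mul_const _))

/-- **THE ONE-FIBRE SWAP, GENERAL TRANSFER, MEASURE LEVEL.**  `κA` (off), `κB` (on) finite measures of equal mass on the slot's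
configuration space, `φ : X → ℝ` the unit-field coordinate as an ARBITRARY measurable function of the slot configuration (the composed
averaging is nonlinear), `m` a reference level, `g` measurable with Taylor majorant `G₂` (no bound on `g'` assumed), `φ − m` in
`L¹ ∩ L²` under both laws:
`|∫ g∘φ dκB − ∫ g∘φ dκA| ≤ |g'(m)|·|∫ (φ − m) dκB − ∫ (φ − m) dκA| + G₂·(∫ (φ − m)² dκA + ∫ (φ − m)² dκB)`. [folklore] -/
theorem abs_integral_swap_le_pointwise (hmass : κA Set.univ = κB Set.univ)
    (hg : ∀ x h : ℝ, |g (x + h) - g x - h * g' x| ≤ G₂ * h ^ 2) (hgm : Measurable g) (hφm : Measurable φ)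
    (hA1 : Integrable (fun x => φ x - m) κA) (hA2 : Integrable (fun x => (φ x - m) ^ 2) κA)
    (hB1 : Integrable (fun x => φ x - m) κB) (hB2 : Integrable (fun x => (φ x - m) ^ 2) κB) :
    |(∫ x, g (φ x) ∂κB) - ∫ x, g (φ x) ∂κA|
      ≤ |g' m| * |(∫ x, (φ x - m) ∂κB) - ∫ x, (φ x - m) ∂κA|
        + G₂ * ((∫ x, (φ x - m) ^ 2 ∂κA) + ∫ x, (φ x - m) ^ 2 ∂κB) := by
  -- Taylor remainder and its bound
  set R : X → ℝ := fun x => g (φ x) - g m - (φ x - m) * g' m with hRdef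
  have hRb : ∀ x, |R x| ≤ G₂ * (φ x - m) ^ 2 := fun x => by
    have h := hg m (φ x - m); rwa [add_sub_cancel] at h
  have hRm : AEStronglyMeasurable R κA ∧ AEStronglyMeasurable R κB := by
    have hm : Measurable R := ((hgm.comp hφm).sub measurable_const).sub ((hφm.sub measurable_const).mul measurable_const)
    exact ⟨hm.aestronglyMeasurable, hm.aestronglyMeasurable⟩
  have hRA : Integrable R κA := Integrable.mono' (hA2.const_mul G₂) hRm.1 (ae_of_all _ fun x => by
    simpa only [Real.norm_eq_abs] using hRb x)
  have hRB : Integrable R κB := Integrable.mono' (hB2.const_mul G₂) hRm.2 (ae_of_all _ fun x => by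
    simpa only [Real.norm_eq_abs] using hRb x)
  -- the decomposition of each integral
  have hdec : ∀ (κ : Measure X) [IsFiniteMeasure κ], Integrable (fun x => φ x - m) κ → Integrable R κ →
      ∫ x, g (φ x) ∂κ = (κ Set.univ).toReal * g m + (∫ x, (φ x - m) ∂κ) * g' m + ∫ x, R x ∂κ := by
    intro κ _ h1 hR
    have e : (fun x => g (φ x)) = fun x => (g m + (φ x - m) * g' m) + R x := by funext x; simp only [hRdef]; ring
    have i0 : Integrable (fun _ : X => g m) κ := integrable_const _
    have i1 : Integrable (fun x => (φ x - m) * g' m) κ := h1.mul_const _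
    have i01 : Integrable (fun x => g m + (φ x - m) * g' m) κ := i0.add i1
    rw [e, integral_add i01 hR, integral_add i0 i1, integral_const, integral_mul_const, smul_eq_mul, measureReal_def]
  rw [hdec κB hB1 hRB, hdec κA hA1 hRA, hmass]
  have hIA : |∫ x, R x ∂κA| ≤ G₂ * ∫ x, (φ x - m) ^ 2 ∂κA := by
    calc |∫ x, R x ∂κA| ≤ ∫ x, |R x| ∂κA := abs_integral_le_integral_abs
      _ ≤ ∫ x, G₂ * (φ x - m) ^ 2 ∂κA := integral_mono hRA.abs (hA2.const_mul G₂) fun x => hRb x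
      _ = G₂ * ∫ x, (φ x - m) ^ 2 ∂κA := integral_const_mul _ _
  have hIB : |∫ x, R x ∂κB| ≤ G₂ * ∫ x, (φ x - m) ^ 2 ∂κB := by
    calc |∫ x, R x ∂κB| ≤ ∫ x, |R x| ∂κB := abs_integral_le_integral_abs
      _ ≤ ∫ x, G₂ * (φ x - m) ^ 2 ∂κB := integral_mono hRB.abs (hB2.const_mul G₂) fun x => hRb x
      _ = G₂ * ∫ x, (φ x - m) ^ 2 ∂κB := integral_const_mul _ _
  have e2 : (κB Set.univ).toReal * g m + (∫ x, (φ x - m) ∂κB) * g' m + (∫ x, R x ∂κB)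
      - ((κB Set.univ).toReal * g m + (∫ x, (φ x - m) ∂κA) * g' m + ∫ x, R x ∂κA)
      = g' m * ((∫ x, (φ x - m) ∂κB) - ∫ x, (φ x - m) ∂κA) + ((∫ x, R x ∂κB) - ∫ x, R x ∂κA) := by ring
  rw [e2]
  calc |g' m * ((∫ x, (φ x - m) ∂κB) - ∫ x, (φ x - m) ∂κA) + ((∫ x, R x ∂κB) - ∫ x, R x ∂κA)|
      ≤ |g' m * ((∫ x, (φ x - m) ∂κB) - ∫ x, (φ x - m) ∂κA)| + |(∫ x, R x ∂κB) - ∫ x, R x ∂κA| := abs_add_le _ _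
    _ ≤ |g' m| * |(∫ x, (φ x - m) ∂κB) - ∫ x, (φ x - m) ∂κA| + (|∫ x, R x ∂κB| + |∫ x, R x ∂κA|) := by
        rw [abs_mul]; exact add_le_add le_rfl (abs_sub _ _)
    _ ≤ |g' m| * |(∫ x, (φ x - m) ∂κB) - ∫ x, (φ x - m) ∂κA|
          + G₂ * ((∫ x, (φ x - m) ^ 2 ∂κA) + ∫ x, (φ x - m) ^ 2 ∂κB) := by
        rw [mul_add]; linarith

end Swap

/-! ## §2 The join with `T4AdInvariant`: at a flat exterior every real-linear readout of an equivariant displacement is centred -/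

section Join

variable {X : Type*} [MeasurableSpace X]

/-- **EVERY READOUT OF AN EQUIVARIANT TRACELESS DISPLACEMENT IS CENTRED UNDER A CONJUGATION-INVARIANT LAW.**  `T` an SU(2)-action on
the slot's configuration space, `κ` a law with `FlatExteriorConjInvariant κ T` (the tree's HYPOTHESIS SHAPE (α)), `D : X → (Fin 2 →
Fin 2 → ℂ)` the 𝔤-valued (log-)displacement of the unit field — `ConjEquivariant T D`, pointwise traceless, integrable; ALL orders of
the nonlinearity of the composed averaging live inside `D` —, `e` a continuous real-linear readout (one unit-field coordinate).  Then
`∫ e (D x) dκ = 0`: the mean displacement is an Ad-invariant vector of 𝔰𝔲(2), hence `0` (`T4AdInvariant.integral_eq_zero_of_conjEquivariant`),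
and `e` commutes with the integral. [folklore] -/
theorem integral_readout_eq_zero {κ : Measure X} {T : Matrix.specialUnitaryGroup (Fin 2) ℂ → X → X}
    (hκ : FlatExteriorConjInvariant κ T) {D : X → Fin 2 → Fin 2 → ℂ} (hD : ConjEquivariant T D)
    (htr : ∀ x, D x 0 0 + D x 1 1 = 0) (hDi : Integrable D κ) (e : (Fin 2 → Fin 2 → ℂ) →L[ℝ] ℝ) :
    ∫ x, e (D x) ∂κ = 0 := by
  rw [ContinuousLinearMap.integral_comp_comm e hDi, integral_eq_zero_of_conjEquivariant hκ hD htr, map_zero]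

/-- **THE FIBREWISE MEAN-DISPLACEMENT DISCREPANCY VANISHES AT A FLAT EXTERIOR.**  Off-law `κA` and on-law `κB` both conjugation
invariant (`FlatExteriorConjInvariant` ×2 — [B15] (0.3): ℝ replaces one conjugation-covariant constraint by another; READING, obligation
(α)), displacement equivariant, traceless, integrable under both, unit-field coordinate `φ x = m + e (D x)`:
`∫ (φ − m) dκB − ∫ (φ − m) dκA = 0` — with NO centring hypothesis on the slot variable and whatever the nonlinearity. [folklore] -/
theorem flat_discrepancy_eq_zero {κA κB : Measure X} {T : Matrix.specialUnitaryGroup (Fin 2) ℂ → X → X}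
    (hκA : FlatExteriorConjInvariant κA T) (hκB : FlatExteriorConjInvariant κB T) {D : X → Fin 2 → Fin 2 → ℂ}
    (hD : ConjEquivariant T D) (htr : ∀ x, D x 0 0 + D x 1 1 = 0) (hDA : Integrable D κA) (hDB : Integrable D κB)
    (e : (Fin 2 → Fin 2 → ℂ) →L[ℝ] ℝ) (m : ℝ) :
    (∫ x, (m + e (D x) - m) ∂κB) - ∫ x, (m + e (D x) - m) ∂κA = 0 := by
  simp only [add_sub_cancel_left]
  rw [integral_readout_eq_zero hκB hD htr hDB e, integral_readout_eq_zero hκA hD htr hDA e, sub_zero]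

end Join

/-! ## §3 At a flat exterior the swap is pure second order — symmetry does the centring, for any nonlinearity -/

section Flat

variable {X : Type*} [MeasurableSpace X] {κA κB : Measure X} [IsFiniteMeasure κA] [IsFiniteMeasure κB]
  {T : Matrix.specialUnitaryGroup (Fin 2) ℂ → X → X} {D : X → Fin 2 → Fin 2 → ℂ} {g g' : ℝ → ℝ} {G₂ : ℝ}

/-- **AT A FLAT EXTERIOR, SYMMETRY CENTRES THE NONLINEAR DISPLACEMENT: PURE SECOND ORDER.**  Both fibre laws conjugation invariant with
equal mass, the displacement `D` equivariant, traceless, measurable and square-integrable in the readout, test function with Taylor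
majorant `G₂`.  Then with `φ = m + e∘D`:
`|∫ g∘φ dκB − ∫ g∘φ dκA| ≤ G₂·(∫ (e∘D)² dκA + ∫ (e∘D)² dκB)` — NO hypothesis on the slot variable's own moments, NO linearity of the
transfer, NO criticality of the test function: the first-order channel is removed by the symmetry alone (§2), its both factors being
needed only OFF the flat orbit (siblings). Kernel modulo the tree's hypothesis shape (α) `FlatExteriorConjInvariant`. [folklore] -/
theorem abs_integral_swap_le_of_flatExterior (hmass : κA Set.univ = κB Set.univ)
    (hκA : FlatExteriorConjInvariant κA T) (hκB : FlatExteriorConjInvariant κB T) (hD : ConjEquivariant T D)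
    (htr : ∀ x, D x 0 0 + D x 1 1 = 0) (hDm : Measurable D) (hDA : Integrable D κA) (hDB : Integrable D κB)
    (e : (Fin 2 → Fin 2 → ℂ) →L[ℝ] ℝ) (m : ℝ)
    (hA2 : Integrable (fun x => (e (D x)) ^ 2) κA) (hB2 : Integrable (fun x => (e (D x)) ^ 2) κB)
    (hg : ∀ x h : ℝ, |g (x + h) - g x - h * g' x| ≤ G₂ * h ^ 2) (hgm : Measurable g) :
    |(∫ x, g (m + e (D x)) ∂κB) - ∫ x, g (m + e (D x)) ∂κA|
      ≤ G₂ * ((∫ x, (e (D x)) ^ 2 ∂κA) + ∫ x, (e (D x)) ^ 2 ∂κB) := by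
  have hφm : Measurable fun x => m + e (D x) := measurable_const.add (e.continuous.measurable.comp hDm)
  have hA1 : Integrable (fun x => m + e (D x) - m) κA := by
    simpa only [add_sub_cancel_left] using (ContinuousLinearMap.integrable_comp e hDA)
  have hB1 : Integrable (fun x => m + e (D x) - m) κB := by
    simpa only [add_sub_cancel_left] using (ContinuousLinearMap.integrable_comp e hDB)
  have hA2' : Integrable (fun x => (m + e (D x) - m) ^ 2) κA := by simpa only [add_sub_cancel_left] using hA2
  have hB2' : Integrable (fun x => (m + e (D x) - m) ^ 2) κB := by simpa only [add_sub_cancel_left] using hB2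
  have h := abs_integral_swap_le_pointwise (φ := fun x => m + e (D x)) (m := m) hmass hg hgm hφm hA1 hA2' hB1 hB2'
  rw [flat_discrepancy_eq_zero hκA hκB hD htr hDA hDB e m, abs_zero, mul_zero, zero_add] at h
  simpa only [add_sub_cancel_left] using h

end Flat

/-! ## §4 (v2, APPEND-ONLY) The cross-bond curvature is centred at a flat exterior: commutators of equivariant bond variables

NE1.md v7.2 R46 (a): by the BCH structure of [B7] (15) the quadratic part of a multi-bond slot's displacement consists of COMMUTATORS
`½[v_b, v_{b′}]` of bond variables (present at a flat background with the gradient's path weight; the diagonal part vanishes there).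
A commutator of two conjugation-equivariant 𝔤-valued maps is equivariant and traceless, so §2 applies to it with no hypothesis on the
factors' traces: its mean under a conjugation-invariant law is `0`.  Kernel modulo the same hypothesis shape (α). -/

section Commutator

open Literature.MathematicalPhysics.QuantumFieldTheory.Balaban1983to89.T4AdInvariant (conjOp conjOp_apply)

variable {X : Type*} [MeasurableSpace X]

/-- The matrix commutator `[a, b] = ab − ba`, written in the function type `Fin 2 → Fin 2 → ℂ` of `T4AdInvariant`. -/
def comm (a b : Fin 2 → Fin 2 → ℂ) : Fin 2 → Fin 2 → ℂ :=
  fun i j => (Matrix.of a * Matrix.of b - Matrix.of b * Matrix.of a) i j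

/-- A commutator is traceless. [folklore] -/
theorem comm_traceless (a b : Fin 2 → Fin 2 → ℂ) : comm a b 0 0 + comm a b 1 1 = 0 := by
  simp only [comm, Matrix.sub_apply, Matrix.mul_apply, Matrix.of_apply, Fin.sum_univ_two]
  ring

/-- Conjugation by a special unitary matrix is multiplicative on `Matrix.of`-products: `U(ab)U⋆ = (UaU⋆)(UbU⋆)`. [folklore] -/
theorem conjOp_mul (U : Matrix.specialUnitaryGroup (Fin 2) ℂ) (a b : Fin 2 → Fin 2 → ℂ) :
    Matrix.of (conjOp (U : Matrix (Fin 2) (Fin 2) ℂ) (fun i j => (Matrix.of a * Matrix.of b) i j))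
      = Matrix.of (conjOp (U : Matrix (Fin 2) (Fin 2) ℂ) a) * Matrix.of (conjOp (U : Matrix (Fin 2) (Fin 2) ℂ) b) := by
  have hU : star (U : Matrix (Fin 2) (Fin 2) ℂ) * (U : Matrix (Fin 2) (Fin 2) ℂ) = 1 :=
    Matrix.UnitaryGroup.star_mul_self ⟨(U : Matrix (Fin 2) (Fin 2) ℂ), U.2.1⟩
  have e1 : Matrix.of (conjOp (U : Matrix (Fin 2) (Fin 2) ℂ) a) = (U : Matrix (Fin 2) (Fin 2) ℂ) * Matrix.of a * star (U : Matrix _ _ ℂ) := by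
    ext i j; simp [conjOp_apply]
  have e2 : Matrix.of (conjOp (U : Matrix (Fin 2) (Fin 2) ℂ) b) = (U : Matrix (Fin 2) (Fin 2) ℂ) * Matrix.of b * star (U : Matrix _ _ ℂ) := by
    ext i j; simp [conjOp_apply]
  have e3 : Matrix.of (conjOp (U : Matrix (Fin 2) (Fin 2) ℂ) (fun i j => (Matrix.of a * Matrix.of b) i j))
      = (U : Matrix (Fin 2) (Fin 2) ℂ) * (Matrix.of a * Matrix.of b) * star (U : Matrix _ _ ℂ) := by
    ext i j; rfl
  rw [e1, e2, e3]
  calc (U : Matrix (Fin 2) (Fin 2) ℂ) * (Matrix.of a * Matrix.of b) * star (U : Matrix _ _ ℂ)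
      = (U : Matrix (Fin 2) (Fin 2) ℂ) * Matrix.of a * (star (U : Matrix _ _ ℂ) * (U : Matrix _ _ ℂ)) * Matrix.of b
          * star (U : Matrix _ _ ℂ) := by rw [hU]; simp only [Matrix.mul_one, Matrix.mul_assoc]
    _ = (U : Matrix (Fin 2) (Fin 2) ℂ) * Matrix.of a * star (U : Matrix _ _ ℂ)
          * ((U : Matrix (Fin 2) (Fin 2) ℂ) * Matrix.of b * star (U : Matrix _ _ ℂ)) := by
        simp only [Matrix.mul_assoc]

omit [MeasurableSpace X] in
/-- **COMMUTATORS OF EQUIVARIANT MAPS ARE EQUIVARIANT.** [folklore] -/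
theorem conjEquivariant_comm {T : Matrix.specialUnitaryGroup (Fin 2) ℂ → X → X} {v w : X → Fin 2 → Fin 2 → ℂ}
    (hv : ConjEquivariant T v) (hw : ConjEquivariant T w) : ConjEquivariant T fun x => comm (v x) (w x) := by
  intro h x
  have key : Matrix.of (comm (v (T h x)) (w (T h x))) = Matrix.of (conjOp (h : Matrix (Fin 2) (Fin 2) ℂ) (comm (v x) (w x))) := by
    have hc : ∀ a b : Fin 2 → Fin 2 → ℂ, Matrix.of (comm a b) = Matrix.of a * Matrix.of b - Matrix.of b * Matrix.of a := by
      intro a b; ext i j; simp [comm]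
    have hlin : Matrix.of (conjOp (h : Matrix (Fin 2) (Fin 2) ℂ) (comm (v x) (w x)))
        = Matrix.of (conjOp (h : Matrix (Fin 2) (Fin 2) ℂ) (fun i j => (Matrix.of (v x) * Matrix.of (w x)) i j))
          - Matrix.of (conjOp (h : Matrix (Fin 2) (Fin 2) ℂ) (fun i j => (Matrix.of (w x) * Matrix.of (v x)) i j)) := by
      have : comm (v x) (w x) = (fun i j => (Matrix.of (v x) * Matrix.of (w x)) i j) - fun i j => (Matrix.of (w x) * Matrix.of (v x)) i j := by
        funext i j; simp [comm, Matrix.sub_apply]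
      rw [this, map_sub]; rfl
    rw [hc, hv h x, hw h x, hlin, conjOp_mul, conjOp_mul]
  funext i j
  have := congrFun (congrFun key i) j
  simpa using this

/-- **THE CROSS-BOND CURVATURE IS CENTRED AT A FLAT EXTERIOR.**  Under `FlatExteriorConjInvariant κ T` (hypothesis shape (α)), for
conjugation-equivariant bond variables `v`, `w` the commutator `x ↦ [v x, w x]` — the BCH quadratic term of the slot's displacement —
has mean ZERO; no integrability and no tracelessness of `v`, `w` needed (`T4AdInvariant.integral_eq_zero_of_conjEquivariant`).
[folklore] -/
theorem integral_comm_eq_zero {κ : Measure X} {T : Matrix.specialUnitaryGroup (Fin 2) ℂ → X → X}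
    (hκ : FlatExteriorConjInvariant κ T) {v w : X → Fin 2 → Fin 2 → ℂ} (hv : ConjEquivariant T v)
    (hw : ConjEquivariant T w) : ∫ x, comm (v x) (w x) ∂κ = 0 :=
  integral_eq_zero_of_conjEquivariant hκ (conjEquivariant_comm hv hw) fun _ => comm_traceless _ _

/-- NON-VACUITY: the commutator is genuinely present — for the two 𝔰𝔲(2) test elements of `T4AdInvariant`, `[diag(i,−i), [[0,1],[−1,0]]]`
has `(0,1)`-entry `2i ≠ 0`.  So the cross-bond curvature of a multi-bond slot is NOT identically zero at a flat background (only its MEAN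
is, `integral_comm_eq_zero`), in contrast with the single-bond (one-parameter) case where the displacement is exactly linear. [folklore] -/
theorem comm_phaseU_swapU_apply :
    comm (fun i j => T4AdInvariant.phaseU i j) (fun i j => T4AdInvariant.swapU i j) 0 1 = 2 * Complex.I := by
  simp [comm, T4AdInvariant.phaseU, T4AdInvariant.swapU, Matrix.sub_apply, Matrix.mul_apply, Fin.sum_univ_two]
  ring

omit [MeasurableSpace X] in
/-- … hence the commutator of the two test elements is non-zero. [folklore] -/
theorem comm_phaseU_swapU_ne_zero :
    comm (fun i j => T4AdInvariant.phaseU i j) (fun i j => T4AdInvariant.swapU i j) ≠ 0 := by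
  intro h
  have h01 := congrFun (congrFun h 0) 1
  rw [comm_phaseU_swapU_apply] at h01
  simp at h01

end Commutator

end Summit.QuantumFields.BalabanUV.T4Continuum.NE1p.TiltedMeanSmoothDualSymmetry

end
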